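import Mathlib
import Summits.Ventures.PercRepro2.BHKEvents

/-!
# Side agreement under `{a_l ↮ a_h}` (PercRepro2, mine-1)

For two roots `l ≠ h` and two further vertices `o, b`, write `Q = {l ↮ h}` and the *side
indicator* `σ_v = 1{v ∈ C_l} − 1{v ∈ C_h}` (on `Q` a vertex lies in at most one root cluster).
**Theorem `side_agreement`**: the side indicators are positively correlated given `Q`, in the
multiplied-out form

  `P(Q) · [P(Q, oL, bL) + P(Q, oH, bH) − P(Q, oL, bH) − P(Q, oH, bL)]
      ≥ [P(Q, oL) − P(Q, oH)] · [P(Q, bL) − P(Q, bH)]`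

(`vL = {v ∈ C_l} = {l ↔ v}`, `vH = {h ↔ v}`). Proof: four instances of van den Berg–Häggström–
Kahn — `bhk_same_cluster_events` at each root (the two "same side" terms, positive association of
`{o ∈ C_x}` and `{b ∈ C_x}`) and `bhk_cross_cluster` for the two "opposite side" terms (negative
correlation across the two clusters) — and the identity `(a − a')(c − c') = ac + a'c' − ac' − a'c`.

**Corollary `same_side_ge_opp_side_of_tie`**: at a labelling tie `P(l ↔ b) = P(h ↔ b)`,
`P(Q, o and b in the same root cluster) ≥ P(Q, o and b in opposite root clusters)` whenever
`P(Q) > 0`. This is the a₃-free half of the tie statement of the crux (MINE-1.md §19–§20): at a tie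
`Z = D·[P(SAME) − P(OPP)] + (a₃-terms)`.
-/

namespace Summit.Ventures.PercRepro2

section SideAgreement

variable {V : Type*} {E : Type*} [Fintype E] [DecidableEq E] [Fintype V] [DecidableEq V]
  {R : Type*} [CommRing R] [LinearOrder R] [IsStrictOrderedRing R]

omit [Fintype E] [DecidableEq E] [Fintype V] [DecidableEq V] in
/-- The family `{W | v ∈ W}` of vertex sets containing `v` is an up-set. -/
lemma isUpperSet_memFam (v : V) : IsUpperSet {W : Set V | v ∈ W} := fun _ _ h hv => h hv

omit [Fintype E] [DecidableEq E] [Fintype V] [DecidableEq V] in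
/-- `{C(x) ∋ v} = {x ↔ v}`. -/
lemma clusterInEvent_memFam (ends : E → Sym2 V) (x v : V) :
    clusterInEvent ends x {W : Set V | v ∈ W} = connEvent ends x v := by
  ext ω
  simp [clusterInEvent, cluster, connEvent]

/-- **Side agreement** (multiplied-out covariance form): with `Q = {l ↮ h}`,
`P(Q)·[P(Q,oL,bL) + P(Q,oH,bH) − P(Q,oL,bH) − P(Q,oH,bL)] ≥ [P(Q,oL) − P(Q,oH)]·[P(Q,bL) − P(Q,bH)]`. -/
theorem side_agreement (p : E → R) (hp : IsProbVec p) (ends : E → Sym2 V) (l h o b : V) :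
    (prob p (connEvent ends l o ∩ connEvent ends l b ∩ (connEvent ends l h)ᶜ) -
        prob p (connEvent ends h o ∩ connEvent ends l b ∩ (connEvent ends l h)ᶜ) -
        prob p (connEvent ends l o ∩ connEvent ends h b ∩ (connEvent ends l h)ᶜ) +
        prob p (connEvent ends h o ∩ connEvent ends h b ∩ (connEvent ends l h)ᶜ)) *
      prob p (connEvent ends l h)ᶜ ≥
    (prob p (connEvent ends l o ∩ (connEvent ends l h)ᶜ) -
        prob p (connEvent ends h o ∩ (connEvent ends l h)ᶜ)) *
      (prob p (connEvent ends l b ∩ (connEvent ends l h)ᶜ) -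
        prob p (connEvent ends h b ∩ (connEvent ends l h)ᶜ)) := by
  -- (1) same cluster at `l`: P(Q,oL)·P(Q,bL) ≤ P(Q,oL,bL)·P(Q)
  have h1 := bhk_same_cluster_events p hp ends l h (isUpperSet_memFam o) (isUpperSet_memFam b)
  -- (2) same cluster at `h`: P(Q,oH)·P(Q,bH) ≤ P(Q,oH,bH)·P(Q)
  have h2 := bhk_same_cluster_events p hp ends h l (isUpperSet_memFam o) (isUpperSet_memFam b)
  -- (3) cross: P(Q,oL,bH)·P(Q) ≤ P(Q,oL)·P(Q,bH)
  have h3 := bhk_cross_cluster p hp ends l h (isUpperSet_memFam o) (isUpperSet_memFam b)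
  -- (4) cross: P(Q,bL,oH)·P(Q) ≤ P(Q,bL)·P(Q,oH)
  have h4 := bhk_cross_cluster p hp ends l h (isUpperSet_memFam b) (isUpperSet_memFam o)
  simp only [clusterInEvent_memFam] at h1 h2 h3 h4
  rw [connEvent_comm ends h l] at h2
  have e4 : connEvent ends l b ∩ connEvent ends h o ∩ (connEvent ends l h)ᶜ =
      connEvent ends h o ∩ connEvent ends l b ∩ (connEvent ends l h)ᶜ := by
    rw [Set.inter_comm (connEvent ends l b)]
  rw [e4] at h4
  nlinarith [h1, h2, h3, h4]

/-- **Same side beats opposite side at a `Q`-tie**: if `P(Q, bL) = P(Q, bH)` and `P(Q) > 0`, then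
`P(Q, oL, bL) + P(Q, oH, bH) ≥ P(Q, oL, bH) + P(Q, oH, bL)`. -/
theorem same_side_ge_opp_side_of_Qtie (p : E → R) (hp : IsProbVec p) (ends : E → Sym2 V)
    (l h o b : V)
    (htie : prob p (connEvent ends l b ∩ (connEvent ends l h)ᶜ) =
      prob p (connEvent ends h b ∩ (connEvent ends l h)ᶜ))
    (hQ : 0 < prob p (connEvent ends l h)ᶜ) :
    prob p (connEvent ends l o ∩ connEvent ends h b ∩ (connEvent ends l h)ᶜ) +
        prob p (connEvent ends h o ∩ connEvent ends l b ∩ (connEvent ends l h)ᶜ) ≤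
      prob p (connEvent ends l o ∩ connEvent ends l b ∩ (connEvent ends l h)ᶜ) +
        prob p (connEvent ends h o ∩ connEvent ends h b ∩ (connEvent ends l h)ᶜ) := by
  have key := side_agreement p hp ends l h o b
  rw [htie, sub_self, mul_zero] at key
  have hX : 0 ≤ prob p (connEvent ends l o ∩ connEvent ends l b ∩ (connEvent ends l h)ᶜ) -
      prob p (connEvent ends h o ∩ connEvent ends l b ∩ (connEvent ends l h)ᶜ) -
      prob p (connEvent ends l o ∩ connEvent ends h b ∩ (connEvent ends l h)ᶜ) +
      prob p (connEvent ends h o ∩ connEvent ends h b ∩ (connEvent ends l h)ᶜ) := by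
    nlinarith [key, hQ]
  linarith

omit [Fintype V] [DecidableEq V] in
/-- The `Q`-tie follows from the labelling tie: `P(l ↔ b) − P(h ↔ b) = P(Q, bL) − P(Q, bH)`
(on `Qᶜ = {l ↔ h}` the two events coincide). -/
lemma prob_conn_sub_eq_Q_sub (p : E → R) (ends : E → Sym2 V) (l h b : V) :
    prob p (connEvent ends l b) - prob p (connEvent ends h b) =
      prob p (connEvent ends l b ∩ (connEvent ends l h)ᶜ) -
        prob p (connEvent ends h b ∩ (connEvent ends l h)ᶜ) := by
  have s1 := prob_inter_add_prob_inter_compl p (connEvent ends l b) (connEvent ends l h)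
  have s2 := prob_inter_add_prob_inter_compl p (connEvent ends h b) (connEvent ends l h)
  have e : connEvent ends l b ∩ connEvent ends l h = connEvent ends h b ∩ connEvent ends l h := by
    ext ω
    simp only [Set.mem_inter_iff, mem_connEvent]
    exact ⟨fun ⟨hb, hlh⟩ => ⟨conn_trans (conn_symm hlh) hb, hlh⟩,
      fun ⟨hb, hlh⟩ => ⟨conn_trans hlh hb, hlh⟩⟩
  rw [e] at s1
  linarith

/-- **Same side beats opposite side at a labelling tie** `P(l ↔ b) = P(h ↔ b)` (with `P(Q) > 0`). -/
theorem same_side_ge_opp_side_of_tie (p : E → R) (hp : IsProbVec p) (ends : E → Sym2 V)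
    (l h o b : V) (htie : prob p (connEvent ends l b) = prob p (connEvent ends h b))
    (hQ : 0 < prob p (connEvent ends l h)ᶜ) :
    prob p (connEvent ends l o ∩ connEvent ends h b ∩ (connEvent ends l h)ᶜ) +
        prob p (connEvent ends h o ∩ connEvent ends l b ∩ (connEvent ends l h)ᶜ) ≤
      prob p (connEvent ends l o ∩ connEvent ends l b ∩ (connEvent ends l h)ᶜ) +
        prob p (connEvent ends h o ∩ connEvent ends h b ∩ (connEvent ends l h)ᶜ) := by
  apply same_side_ge_opp_side_of_Qtie p hp ends l h o b _ hQ
  have := prob_conn_sub_eq_Q_sub p ends l h b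
  rw [htie, sub_self] at this
  linarith

end SideAgreement

end Summit.Ventures.PercRepro2
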